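import Summits.QuantumFields.YangMills.Theorems.UnitScaleTiltCoverDeltaA
import Summits.QuantumFields.YangMills.Theorems.UnitScaleTiltCoverPullback
import Summits.QuantumFields.YangMills.Theorems.UnitScaleTiltCoverDomains
import Summits.QuantumFields.YangMills.Theorems.UnitScaleTiltCoverSitesBlocks
import Summits.QuantumFields.YangMills.Theorems.UnitScaleTiltProp8FlatOpsLettersAssembly
import HarnessLib

/-!
# Route `UnitScaleTilt`, crux K1 child «MinimiserStabilityRegPr» (stmt-QuantumFields-19200), registered stub `stub_halvingStep` (H), branch (P2-small),
# mechanism of record **(α) COVERING ∕ PERIODISATION** (OWNER RULING g26-№18) — file `CoverFlatH`: **THE KEY LEMMA, INSTANTIATED AT THE COVERING MAP —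
# `flatH (F.cover jc) n K (D.comap jc) (X ∘ projIdx) b̃ = flatH F n K D X (projBond b̃)` (+ the `G̃` twin)** modulo the four multi-scale average identities of
# [Balaban1984PropagatorsI] (1.18)∕(1.20) read through `proj` (displayed; LEAD's range-restricted `…CoverAveragesRange` discharges them)

Cell `ym3-torus` (HUMAN RULING D-0037, YM ladder rung R3 — continuum SU(2) YM₃ on the torus is a RUNG, not the Clay problem), width seat `ym-ust-20520-w1` gen 5,
following LEAD `ym-ust-19200-w5` g3's FINAL HANDOFF § and his 08:58:16Z instantiation recipe by name (✓`CoverFlatOps.hOp_pull` of `…CoverDeltaA`).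
`--supports stmt-QuantumFields-19200 --as helper`; def-free, 0 sorry, standard axioms.

WHAT IS DISCHARGED HERE of `hOp_pull`'s binders at `φ := proj P jc 0`, `D′ := D.comap jc`, `ψI := projIdx D jc`, `ψS := the site-index projection` (inline):
`hd := rfl`; `hs hu` := ✓`proj_shift_cast`∕`proj_unshift_cast`; the five fibre-sum maps `ρ := LinearMap.adjoint (onE (LinearMap.funLeft ℝ ℝ ψ))` with their specs
✓`CoverPullback.adjoint_onE_funLeft_apply`; the per-index forms of the four `Q`∕`Q′` facts from the FUNCTION-LEVEL identities `hbpull hbpush hspull hspush` (range-restricted,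
`k ≤ m + K`) via two fibre bijections (`idxFibre_bijective`, `sidxFibre_bijective`: the fibre of an index bond∕site under `projIdx`∕`ψS` ≃ the fibre of its source site under `proj`);
and the reading of `hOp` through ✓`IsFlatH`∕`IsFlatGt` (weights `a ≡ 1`, lattice factor `L^{K−n}` — identical on both lattices since `(F.cover jc).L = F.L` rfl).
* ★★`flatH_cover_of (hbpull hbpush hspull hspush) (X) (bt) : flatH (F.cover jc) n K (D.comap jc) (X ∘ projIdx D jc) bt = flatH F n K D X (projBond (F.P K) jc 0 bt)`;
* ★`isFlatH_cover_of` (ANY `H`, `H̃` pinned by `IsFlatH` — α5's `hH` binder), ★`isFlatGt_cover_of` (the `G̃ = G − HQG` twin via ✓`Gt_intertwine` — α5's `hGt` binder).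
HONEST SCOPE: linear algebra; NOT a claim about the H stub, the crux, the rung or a mass gap.

References: T. Bałaban, CMP **96** (1984) 223–250 [Balaban1984PropagatorsII] (2.18)–(2.22) p.226, (2.35) p.228; CMP **102** (1985) 277–309 [Balaban1985Variational] (45) p.285,
(143) p.300, (157)–(158) p.302; CMP **95** (1984) 17–40 [Balaban1984PropagatorsI] (1.18), (1.20) p.20.
-/

set_option autoImplicit false

noncomputable section

open scoped BigOperators InnerProductSpace Classical

namespace Summit.QuantumFields.YangMills.Theorems.CoverFlatH

open Literature.MathematicalPhysics.QuantumFieldTheory.Balaban1983to89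
open LatticeFieldCalculus (siteAvgIter bondAvgIter)
open B6SectADomainsV1 (Domains)
open B6SectAOperatorsV1 (onE ScalarSpace SiteIdx BondIdx SiteIdxSpace BondIdxSpace QE QsE)
open B6SectAVectorModelV1 (deltaAE GE EE)
open B6SectA (hOp)
open Literature.MathematicalPhysics.QuantumFieldTheory.BalabanImbrieJaffe1984to88.BIJ85AxialPropagator411 (BondSpace PlaqSpace)
open T3ContinuumYM3Torus (T3Family)
open CoverSites (cover proj projBond projPlaq proj_shift_cast proj_unshift_cast)
open CoverDomains (projIdx liftIdx projIdx_liftIdx lamSite_comap_iff lamBond_comap_iff)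
open CoverPullback (adjoint_onE_funLeft_apply cover_d_eq)
open CoverFlatOps (hOp_pull deltaAE_pull QE_pull QsE_pull Gt_intertwine)
open FlatCubeOpsText (IsFlatH IsFlatGt)
open FlatOpsLettersAssembly (flatH)

variable {P : Params} (D : Domains P) (jc : ℕ)

/-! ## §1 The two fibre bijections: index bonds ∕ index sites over their source sites -/

/-- a lift of the source site with the same direction projects onto the index bond's bond. [cite: Balaban1984PropagatorsII, (2.3) p.224] -/
theorem projBond_mk_eq (c : BondIdx D) (yt : Site (cover P jc) (c.1.1 : ℕ)) (h : proj P jc (c.1.1 : ℕ) yt = c.1.2.src) :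
    projBond P jc (c.1.1 : ℕ) ⟨yt, c.1.2.dir⟩ = c.1.2 := by
  show (⟨proj P jc (c.1.1 : ℕ) yt, c.1.2.dir⟩ : PBond P (c.1.1 : ℕ)) = c.1.2
  rw [h]

/-- **THE FIBRE OF AN INDEX BOND UNDER `projIdx` ≃ THE FIBRE OF ITS SOURCE SITE UNDER `proj`** (the level and the direction are forced; `Λ̃_j = proj⁻¹Λ_j`;
the map is α2's `liftIdx`). [cite: Balaban1984PropagatorsII, (2.3) p.224] -/
theorem idxFibre_bijective (c : BondIdx D) :
    Function.Bijective (fun yt : {yt : Site (cover P jc) (c.1.1 : ℕ) // proj P jc (c.1.1 : ℕ) yt = c.1.2.src} =>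
      (⟨liftIdx D jc c ⟨yt.1, c.1.2.dir⟩ (projBond_mk_eq D jc c yt.1 yt.2), projIdx_liftIdx D jc c _ _⟩ :
        {ct : BondIdx (D.comap jc) // projIdx D jc ct = c})) := by
  constructor
  · intro y₁ y₂ h
    have h1 : liftIdx D jc c ⟨y₁.1, c.1.2.dir⟩ (projBond_mk_eq D jc c y₁.1 y₁.2) = liftIdx D jc c ⟨y₂.1, c.1.2.dir⟩ (projBond_mk_eq D jc c y₂.1 y₂.2) :=
      congrArg Subtype.val h
    have h2 : (⟨c.1.1, ⟨y₁.1, c.1.2.dir⟩⟩ : (j : Fin (D.k + 1)) × PBond (cover P jc) (j : ℕ)) = ⟨c.1.1, ⟨y₂.1, c.1.2.dir⟩⟩ :=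
      congrArg Subtype.val h1
    have h3 : (⟨y₁.1, c.1.2.dir⟩ : PBond (cover P jc) (c.1.1 : ℕ)) = ⟨y₂.1, c.1.2.dir⟩ := eq_of_heq (Sigma.mk.inj_iff.1 h2).2
    exact Subtype.ext (by simpa using congrArg PBond.src h3)
  · rintro ⟨ct, hct⟩
    subst hct
    obtain ⟨⟨j, ⟨x, μ⟩⟩, hjb⟩ := ct
    exact ⟨⟨x, rfl⟩, rfl⟩

/-- **THE FIBRE OF AN INDEX SITE UNDER THE SITE-INDEX PROJECTION ≃ THE FIBRE OF THE SITE UNDER `proj`**. [cite: Balaban1984PropagatorsII, (2.3) p.224] -/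
theorem sidxFibre_bijective (s : SiteIdx D) :
    Function.Bijective (fun yt : {yt : Site (cover P jc) (s.1.1 : ℕ) // proj P jc (s.1.1 : ℕ) yt = s.1.2} =>
      (⟨⟨⟨s.1.1, yt.1⟩, (lamSite_comap_iff D jc _ _).2 (by rw [yt.2]; exact s.2)⟩,
        Subtype.ext (by show (⟨s.1.1, proj P jc (s.1.1 : ℕ) yt.1⟩ : (j : Fin (D.k + 1)) × Site P (j : ℕ)) = s.1; rw [yt.2])⟩ :
        {st : SiteIdx (D.comap jc) //
          (⟨⟨st.1.1, proj P jc (st.1.1 : ℕ) st.1.2⟩, (lamSite_comap_iff D jc _ _).1 st.2⟩ : SiteIdx D) = s})) := by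
  constructor
  · intro y₁ y₂ h
    have h1 := congrArg (fun st : {st : SiteIdx (D.comap jc) //
      (⟨⟨st.1.1, proj P jc (st.1.1 : ℕ) st.1.2⟩, (lamSite_comap_iff D jc _ _).1 st.2⟩ : SiteIdx D) = s} => st.1.1) h
    exact Subtype.ext (eq_of_heq (Sigma.mk.inj_iff.1 h1).2)
  · rintro ⟨st, hst⟩
    subst hst
    obtain ⟨⟨j, x⟩, hjx⟩ := st
    exact ⟨⟨x, rfl⟩, rfl⟩

/-! ## §2 The key lemma at the covering map, modulo the four average identities -/

section T3

variable (F : T3Family) (n K : ℕ) (jc : ℕ) (D : Domains (F.P K))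

/-- the instantiation of ✓`CoverFlatOps.hOp_pull` at `proj`, `D.comap`, `projIdx` and the fibre sums `π†` — any weights. [cite: Balaban1984PropagatorsII, (2.35) p.228] -/
theorem hOp_pull_proj {c : ℝ} (hc : c ≠ 0) {w : BondIdx D → ℝ} (hw : ∀ i, 0 < w i)
    (hbpull : ∀ (A : VecField (F.P K) 0 ℝ) (k : ℕ), k ≤ (F.P K).m + (F.P K).K → ∀ ct : PBond (cover (F.P K) jc) k,
      bondAvgIter k (fun b' : PBond (cover (F.P K) jc) 0 => A ⟨proj (F.P K) jc 0 b'.src, Fin.cast rfl b'.dir⟩) ct =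
        bondAvgIter k A ⟨proj (F.P K) jc k ct.src, Fin.cast rfl ct.dir⟩)
    (hbpush : ∀ (g : VecField (cover (F.P K) jc) 0 ℝ) (k : ℕ), k ≤ (F.P K).m + (F.P K).K → ∀ (y : Site (F.P K) k) (μ : Fin (cover (F.P K) jc).d),
      bondAvgIter k (fun b : PBond (F.P K) 0 => ∑ b' : {b' : PBond (cover (F.P K) jc) 0 //
          (⟨proj (F.P K) jc 0 b'.src, Fin.cast rfl b'.dir⟩ : PBond (F.P K) 0) = b}, g b'.1) ⟨y, Fin.cast rfl μ⟩ =
        ∑ y' : {y' : Site (cover (F.P K) jc) k // proj (F.P K) jc k y' = y}, bondAvgIter k g ⟨y'.1, μ⟩)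
    (hspull : ∀ (f : SiteField (F.P K) 0 ℝ) (k : ℕ), k ≤ (F.P K).m + (F.P K).K →
      siteAvgIter k (f ∘ proj (F.P K) jc 0) = siteAvgIter k f ∘ proj (F.P K) jc k)
    (hspush : ∀ (g : SiteField (cover (F.P K) jc) 0 ℝ) (k : ℕ), k ≤ (F.P K).m + (F.P K).K → ∀ y : Site (F.P K) k,
      siteAvgIter k (fun x => ∑ x' : {x' : Site (cover (F.P K) jc) 0 // proj (F.P K) jc 0 x' = x}, g x'.1) y =
        ∑ y' : {y' : Site (cover (F.P K) jc) k // proj (F.P K) jc k y' = y}, siteAvgIter k g y'.1)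
    (ω : BondIdxSpace D) :
    hOp (GE (D.comap jc) hc (w := w ∘ projIdx D jc) (fun i => hw (projIdx D jc i))) (QsE (D.comap jc))
        (EE (D.comap jc) hc (w := w ∘ projIdx D jc) (fun i => hw (projIdx D jc i))) (onE (LinearMap.funLeft ℝ ℝ (projIdx D jc)) ω) =
      onE (LinearMap.funLeft ℝ ℝ (fun b' : PBond (cover (F.P K) jc) 0 => (⟨proj (F.P K) jc 0 b'.src, Fin.cast rfl b'.dir⟩ : PBond (F.P K) 0)))
        (hOp (GE D hc hw) (QsE D) (EE D hc hw) ω) := by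
  refine hOp_pull (cover_d_eq (F.P K) jc) (proj (F.P K) jc 0) (proj_shift_cast (F.P K) jc 0 (cover_d_eq (F.P K) jc))
    (proj_unshift_cast (F.P K) jc 0 (cover_d_eq (F.P K) jc)) D (D.comap jc) (projIdx D jc)
    (fun st => ⟨⟨st.1.1, proj (F.P K) jc (st.1.1 : ℕ) st.1.2⟩, (lamSite_comap_iff D jc _ _).1 st.2⟩) hc hw
    (LinearMap.adjoint (onE (LinearMap.funLeft ℝ ℝ (proj (F.P K) jc 0))))
    (LinearMap.adjoint (onE (LinearMap.funLeft ℝ ℝ (fun b' : PBond (cover (F.P K) jc) 0 => (⟨proj (F.P K) jc 0 b'.src, Fin.cast rfl b'.dir⟩ : PBond (F.P K) 0)))))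
    (LinearMap.adjoint (onE (LinearMap.funLeft ℝ ℝ (fun p' : Plaq (cover (F.P K) jc) 0 =>
      (⟨proj (F.P K) jc 0 p'.src, Fin.cast rfl p'.μ, Fin.cast rfl p'.ν, Fin.lt_def.mpr (Fin.lt_def.mp p'.hμν)⟩ : Plaq (F.P K) 0)))))
    (LinearMap.adjoint (onE (LinearMap.funLeft ℝ ℝ (projIdx D jc))))
    (LinearMap.adjoint (onE (LinearMap.funLeft ℝ ℝ
      (fun st : SiteIdx (D.comap jc) => (⟨⟨st.1.1, proj (F.P K) jc (st.1.1 : ℕ) st.1.2⟩, (lamSite_comap_iff D jc _ _).1 st.2⟩ : SiteIdx D)))))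
    (fun g x => adjoint_onE_funLeft_apply _ g x) (fun g b => adjoint_onE_funLeft_apply _ g b) (fun g p => adjoint_onE_funLeft_apply _ g p)
    (fun g c' => adjoint_onE_funLeft_apply _ g c') (fun g s => adjoint_onE_funLeft_apply _ g s)
    (fun A c' => ?_) (fun g c' => ?_) (fun f s' => ?_) (fun g s => ?_) ω
  · -- `Q` with the pullback, per index bond (levels of `projIdx c′` and `c′` agree by rfl)
    exact (hbpull A _ (le_trans (Nat.lt_succ_iff.1 c'.1.1.isLt) D.hk) c'.1.2).symm
  · -- `Q` with the fibre sums: LEAD's site-fibre form re-indexed over the index-bond fibre (`c′.1.2 = ⟨src, dir⟩` by eta)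
    have h1 := hbpush g _ (le_trans (Nat.lt_succ_iff.1 c'.1.1.isLt) D.hk) c'.1.2.src c'.1.2.dir
    have h2 := Fintype.sum_bijective _ (idxFibre_bijective D jc c') (fun yt => bondAvgIter (c'.1.1 : ℕ) g ⟨yt.1, c'.1.2.dir⟩)
      (fun ct => bondAvgIter (ct.1.1.1 : ℕ) g ct.1.1.2) (fun yt => rfl)
    exact h2.symm.trans h1.symm
  · -- `Q′` with the pullback, per index site
    exact (congrFun (hspull f _ (le_trans (Nat.lt_succ_iff.1 s'.1.1.isLt) D.hk)) s'.1.2).symm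
  · -- `Q′` with the fibre sums
    rw [hspush g _ (le_trans (Nat.lt_succ_iff.1 s.1.1.isLt) D.hk) s.1.2]
    exact (Fintype.sum_bijective _ (sidxFibre_bijective D jc s) _ _ fun yt => rfl).symm

/-- ★★ **THE KEY LEMMA OF THE (α) BRANCH, AT THE COVERING MAP** (modulo the four average identities): the CANONICAL `H` ((45)∕(157): `flatH`, weights `a ≡ 1`,
lattice factor `L^{K−n}`) of the covering member `F.cover jc` on the lifted family `D.comap jc`, applied to periodic data `X ∘ projIdx`, is the periodic extension of
the small member's `H X`: `flatH (F.cover jc) n K (D.comap jc) (X ∘ projIdx) b̃ = flatH F n K D X (projBond b̃)`.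
[cite: Balaban1985Variational, (45) p.285, (157) p.302; Balaban1984PropagatorsII, (2.35) p.228] -/
theorem flatH_cover_of
    (hbpull : ∀ (A : VecField (F.P K) 0 ℝ) (k : ℕ), k ≤ (F.P K).m + (F.P K).K → ∀ ct : PBond (cover (F.P K) jc) k,
      bondAvgIter k (fun b' : PBond (cover (F.P K) jc) 0 => A ⟨proj (F.P K) jc 0 b'.src, Fin.cast rfl b'.dir⟩) ct =
        bondAvgIter k A ⟨proj (F.P K) jc k ct.src, Fin.cast rfl ct.dir⟩)
    (hbpush : ∀ (g : VecField (cover (F.P K) jc) 0 ℝ) (k : ℕ), k ≤ (F.P K).m + (F.P K).K → ∀ (y : Site (F.P K) k) (μ : Fin (cover (F.P K) jc).d),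
      bondAvgIter k (fun b : PBond (F.P K) 0 => ∑ b' : {b' : PBond (cover (F.P K) jc) 0 //
          (⟨proj (F.P K) jc 0 b'.src, Fin.cast rfl b'.dir⟩ : PBond (F.P K) 0) = b}, g b'.1) ⟨y, Fin.cast rfl μ⟩ =
        ∑ y' : {y' : Site (cover (F.P K) jc) k // proj (F.P K) jc k y' = y}, bondAvgIter k g ⟨y'.1, μ⟩)
    (hspull : ∀ (f : SiteField (F.P K) 0 ℝ) (k : ℕ), k ≤ (F.P K).m + (F.P K).K →
      siteAvgIter k (f ∘ proj (F.P K) jc 0) = siteAvgIter k f ∘ proj (F.P K) jc k)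
    (hspush : ∀ (g : SiteField (cover (F.P K) jc) 0 ℝ) (k : ℕ), k ≤ (F.P K).m + (F.P K).K → ∀ y : Site (F.P K) k,
      siteAvgIter k (fun x => ∑ x' : {x' : Site (cover (F.P K) jc) 0 // proj (F.P K) jc 0 x' = x}, g x'.1) y =
        ∑ y' : {y' : Site (cover (F.P K) jc) k // proj (F.P K) jc k y' = y}, siteAvgIter k g y'.1)
    (X : BondIdx D → ℝ) (bt : PBond (cover (F.P K) jc) 0) :
    flatH (F.cover jc) n K (D.comap jc) (X ∘ projIdx D jc) bt = flatH F n K D X (projBond (F.P K) jc 0 bt) := by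
  have h := hOp_pull_proj F K jc D (c := (F.L : ℝ) ^ (K - n)) (pow_ne_zero _ (Nat.cast_ne_zero.2 (F.P K).L_pos.ne')) (w := fun _ => (1 : ℝ))
    (fun _ => one_pos) hbpull hbpush hspull hspush (WithLp.toLp 2 X)
  exact congrArg (fun v : BondSpace (cover (F.P K) jc) => v bt) h

/-- ★ **THE SAME FOR ANY TWO OPERATORS PINNED BY `IsFlatH`** (`H` on `D`, `Ht` on `D.comap jc`) — α5's `hH` binder. [cite: Balaban1985Variational, (45) p.285, (157) p.302] -/
theorem isFlatH_cover_of
    (hbpull : ∀ (A : VecField (F.P K) 0 ℝ) (k : ℕ), k ≤ (F.P K).m + (F.P K).K → ∀ ct : PBond (cover (F.P K) jc) k,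
      bondAvgIter k (fun b' : PBond (cover (F.P K) jc) 0 => A ⟨proj (F.P K) jc 0 b'.src, Fin.cast rfl b'.dir⟩) ct =
        bondAvgIter k A ⟨proj (F.P K) jc k ct.src, Fin.cast rfl ct.dir⟩)
    (hbpush : ∀ (g : VecField (cover (F.P K) jc) 0 ℝ) (k : ℕ), k ≤ (F.P K).m + (F.P K).K → ∀ (y : Site (F.P K) k) (μ : Fin (cover (F.P K) jc).d),
      bondAvgIter k (fun b : PBond (F.P K) 0 => ∑ b' : {b' : PBond (cover (F.P K) jc) 0 //
          (⟨proj (F.P K) jc 0 b'.src, Fin.cast rfl b'.dir⟩ : PBond (F.P K) 0) = b}, g b'.1) ⟨y, Fin.cast rfl μ⟩ =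
        ∑ y' : {y' : Site (cover (F.P K) jc) k // proj (F.P K) jc k y' = y}, bondAvgIter k g ⟨y'.1, μ⟩)
    (hspull : ∀ (f : SiteField (F.P K) 0 ℝ) (k : ℕ), k ≤ (F.P K).m + (F.P K).K →
      siteAvgIter k (f ∘ proj (F.P K) jc 0) = siteAvgIter k f ∘ proj (F.P K) jc k)
    (hspush : ∀ (g : SiteField (cover (F.P K) jc) 0 ℝ) (k : ℕ), k ≤ (F.P K).m + (F.P K).K → ∀ y : Site (F.P K) k,
      siteAvgIter k (fun x => ∑ x' : {x' : Site (cover (F.P K) jc) 0 // proj (F.P K) jc 0 x' = x}, g x'.1) y =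
        ∑ y' : {y' : Site (cover (F.P K) jc) k // proj (F.P K) jc k y' = y}, siteAvgIter k g y'.1)
    {H : (BondIdx D → ℝ) →ₗ[ℝ] (PBond (F.P K) 0 → ℝ)} {Ht : (BondIdx (D.comap jc) → ℝ) →ₗ[ℝ] (PBond ((F.cover jc).P K) 0 → ℝ)}
    (hH : IsFlatH F n K D H) (hHt : IsFlatH (F.cover jc) n K (D.comap jc) Ht) (X : BondIdx D → ℝ) (bt : PBond (cover (F.P K) jc) 0) :
    Ht (X ∘ projIdx D jc) bt = H X (projBond (F.P K) jc 0 bt) := by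
  have e1 : Ht (X ∘ projIdx D jc) bt = flatH (F.cover jc) n K (D.comap jc) (X ∘ projIdx D jc) bt := hHt _ bt
  have e2 : H X (projBond (F.P K) jc 0 bt) = flatH F n K D X (projBond (F.P K) jc 0 bt) := hH X _
  rw [e1, e2]
  exact flatH_cover_of F n K jc D hbpull hbpush hspull hspush X bt

/-- ★ **THE `G̃ = G − HQG` TWIN FOR ANY TWO OPERATORS PINNED BY `IsFlatGt`** — α5's `hGt` binder. [cite: Balaban1985Variational, (143) p.300, (158) p.302] -/
theorem isFlatGt_cover_of
    (hbpull : ∀ (A : VecField (F.P K) 0 ℝ) (k : ℕ), k ≤ (F.P K).m + (F.P K).K → ∀ ct : PBond (cover (F.P K) jc) k,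
      bondAvgIter k (fun b' : PBond (cover (F.P K) jc) 0 => A ⟨proj (F.P K) jc 0 b'.src, Fin.cast rfl b'.dir⟩) ct =
        bondAvgIter k A ⟨proj (F.P K) jc k ct.src, Fin.cast rfl ct.dir⟩)
    (hbpush : ∀ (g : VecField (cover (F.P K) jc) 0 ℝ) (k : ℕ), k ≤ (F.P K).m + (F.P K).K → ∀ (y : Site (F.P K) k) (μ : Fin (cover (F.P K) jc).d),
      bondAvgIter k (fun b : PBond (F.P K) 0 => ∑ b' : {b' : PBond (cover (F.P K) jc) 0 //
          (⟨proj (F.P K) jc 0 b'.src, Fin.cast rfl b'.dir⟩ : PBond (F.P K) 0) = b}, g b'.1) ⟨y, Fin.cast rfl μ⟩ =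
        ∑ y' : {y' : Site (cover (F.P K) jc) k // proj (F.P K) jc k y' = y}, bondAvgIter k g ⟨y'.1, μ⟩)
    (hspull : ∀ (f : SiteField (F.P K) 0 ℝ) (k : ℕ), k ≤ (F.P K).m + (F.P K).K →
      siteAvgIter k (f ∘ proj (F.P K) jc 0) = siteAvgIter k f ∘ proj (F.P K) jc k)
    (hspush : ∀ (g : SiteField (cover (F.P K) jc) 0 ℝ) (k : ℕ), k ≤ (F.P K).m + (F.P K).K → ∀ y : Site (F.P K) k,
      siteAvgIter k (fun x => ∑ x' : {x' : Site (cover (F.P K) jc) 0 // proj (F.P K) jc 0 x' = x}, g x'.1) y =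
        ∑ y' : {y' : Site (cover (F.P K) jc) k // proj (F.P K) jc k y' = y}, siteAvgIter k g y'.1)
    {Gt : (PBond (F.P K) 0 → ℝ) →ₗ[ℝ] (PBond (F.P K) 0 → ℝ)} {Gtt : (PBond ((F.cover jc).P K) 0 → ℝ) →ₗ[ℝ] (PBond ((F.cover jc).P K) 0 → ℝ)}
    (hG : IsFlatGt F n K D Gt) (hGt : IsFlatGt (F.cover jc) n K (D.comap jc) Gtt) (f : PBond (F.P K) 0 → ℝ) (bt : PBond (cover (F.P K) jc) 0) :
    Gtt (fun b => f (projBond (F.P K) jc 0 b)) bt = Gt f (projBond (F.P K) jc 0 bt) := by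
  have e1 := hGt (fun b => f (projBond (F.P K) jc 0 b)) bt
  have e2 := hG f (projBond (F.P K) jc 0 bt)
  rw [e1, e2]
  have hc : ((F.L : ℝ) ^ (K - n)) ≠ 0 := pow_ne_zero _ (Nat.cast_ne_zero.2 (F.P K).L_pos.ne')
    -- re-derive the `G̃` statement from ✓`Gt_intertwine` with the same local data
  have h := Gt_intertwine D (D.comap jc) hc (w := fun _ => (1 : ℝ)) (fun _ => one_pos) (w' := fun _ => (1 : ℝ)) (fun _ => one_pos)
    (onE (LinearMap.funLeft ℝ ℝ (fun b' : PBond (cover (F.P K) jc) 0 => (⟨proj (F.P K) jc 0 b'.src, Fin.cast rfl b'.dir⟩ : PBond (F.P K) 0))))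
    (onE (LinearMap.funLeft ℝ ℝ (projIdx D jc)))
    (deltaAE_pull (cover_d_eq (F.P K) jc) (proj (F.P K) jc 0) (proj_shift_cast (F.P K) jc 0 (cover_d_eq (F.P K) jc))
      (proj_unshift_cast (F.P K) jc 0 (cover_d_eq (F.P K) jc)) D (D.comap jc) (projIdx D jc)
      (fun st => ⟨⟨st.1.1, proj (F.P K) jc (st.1.1 : ℕ) st.1.2⟩, (lamSite_comap_iff D jc _ _).1 st.2⟩) _ (fun _ => (1 : ℝ))
      (LinearMap.adjoint (onE (LinearMap.funLeft ℝ ℝ (proj (F.P K) jc 0))))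
      (LinearMap.adjoint (onE (LinearMap.funLeft ℝ ℝ (fun b' : PBond (cover (F.P K) jc) 0 => (⟨proj (F.P K) jc 0 b'.src, Fin.cast rfl b'.dir⟩ : PBond (F.P K) 0)))))
      (LinearMap.adjoint (onE (LinearMap.funLeft ℝ ℝ (fun p' : Plaq (cover (F.P K) jc) 0 =>
        (⟨proj (F.P K) jc 0 p'.src, Fin.cast rfl p'.μ, Fin.cast rfl p'.ν, Fin.lt_def.mpr (Fin.lt_def.mp p'.hμν)⟩ : Plaq (F.P K) 0)))))
      (LinearMap.adjoint (onE (LinearMap.funLeft ℝ ℝ (projIdx D jc))))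
      (LinearMap.adjoint (onE (LinearMap.funLeft ℝ ℝ
        (fun st : SiteIdx (D.comap jc) => (⟨⟨st.1.1, proj (F.P K) jc (st.1.1 : ℕ) st.1.2⟩, (lamSite_comap_iff D jc _ _).1 st.2⟩ : SiteIdx D)))))
      (fun g x => adjoint_onE_funLeft_apply _ g x) (fun g b => adjoint_onE_funLeft_apply _ g b) (fun g p => adjoint_onE_funLeft_apply _ g p)
      (fun g c' => adjoint_onE_funLeft_apply _ g c') (fun g s => adjoint_onE_funLeft_apply _ g s)
      (fun A c' => (hbpull A _ (le_trans (Nat.lt_succ_iff.1 c'.1.1.isLt) D.hk) c'.1.2).symm)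
      (fun g c' => (Fintype.sum_bijective _ (idxFibre_bijective D jc c') (fun yt => bondAvgIter (c'.1.1 : ℕ) g ⟨yt.1, c'.1.2.dir⟩)
          (fun ct => bondAvgIter (ct.1.1.1 : ℕ) g ct.1.1.2) (fun yt => rfl)).symm.trans
        (hbpush g _ (le_trans (Nat.lt_succ_iff.1 c'.1.1.isLt) D.hk) c'.1.2.src c'.1.2.dir).symm)
      (fun f s' => (congrFun (hspull f _ (le_trans (Nat.lt_succ_iff.1 s'.1.1.isLt) D.hk)) s'.1.2).symm)
      (fun g s => by
        rw [hspush g _ (le_trans (Nat.lt_succ_iff.1 s.1.1.isLt) D.hk) s.1.2]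
        exact (Fintype.sum_bijective _ (sidxFibre_bijective D jc s) _ _ fun yt => rfl).symm))
    (QE_pull (cover_d_eq (F.P K) jc) (proj (F.P K) jc 0) D (D.comap jc) (projIdx D jc)
      (fun A c' => (hbpull A _ (le_trans (Nat.lt_succ_iff.1 c'.1.1.isLt) D.hk) c'.1.2).symm))
    (QsE_pull (cover_d_eq (F.P K) jc) (proj (F.P K) jc 0) D (D.comap jc) (projIdx D jc)
      (LinearMap.adjoint (onE (LinearMap.funLeft ℝ ℝ (fun b' : PBond (cover (F.P K) jc) 0 => (⟨proj (F.P K) jc 0 b'.src, Fin.cast rfl b'.dir⟩ : PBond (F.P K) 0)))))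
      (LinearMap.adjoint (onE (LinearMap.funLeft ℝ ℝ (projIdx D jc))))
      (fun g b => adjoint_onE_funLeft_apply _ g b) (fun g c' => adjoint_onE_funLeft_apply _ g c')
      (fun g c' => (Fintype.sum_bijective _ (idxFibre_bijective D jc c') (fun yt => bondAvgIter (c'.1.1 : ℕ) g ⟨yt.1, c'.1.2.dir⟩)
          (fun ct => bondAvgIter (ct.1.1.1 : ℕ) g ct.1.1.2) (fun yt => rfl)).symm.trans
        (hbpush g _ (le_trans (Nat.lt_succ_iff.1 c'.1.1.isLt) D.hk) c'.1.2.src c'.1.2.dir).symm))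
    (WithLp.toLp 2 f)
  exact congrArg (fun v : BondSpace (cover (F.P K) jc) => v bt) h

end T3

end Summit.QuantumFields.YangMills.Theorems.CoverFlatH

end
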